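import Literature.Probability.Percolation.ConditionalPositiveAssociationProofs
import Mathlib.Combinatorics.SetFamily.FourFunctions
import HarnessLib

/-!
# `NoHeavyLowerTail` (stmt-CriticalPhenomena-4575) — antithetic (red/blue) cluster pairs: the Harris layer
# (prim-hp-2 gen 31, MEMO-gen31 §1d, §4b)

Support file (`--supports stmt-CriticalPhenomena-4575`, hull-port prover `prim-hp-2`, gen 31).  No definitions, no
named facts, no sorries; standard axioms.

Setting (MEMO-gen29 §3, MEMO-gen31): a configuration `ω ⊆ Sym2 V` is read as a 2-colouring of the pairs — `ω` red,
`ωᶜ` blue — and for a fixed edge set `E` and source `s` the RED cluster is the open edge cluster of `s` in `ω ∩ E`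
(`Literature.Probability.Percolation.openEdgeCluster`), the BLUE cluster that of `ωᶜ ∩ E`.  Summing over all
`ω` is the uniform (p = ½) law; `ω ↦ ωᶜ` swaps the two clusters and preserves it.  The conjectured ANTITHETIC BHK
inequality (SC) compares `E[f(red) g(red)]` with `E[f(red) g(blue)]` under the conditioning `both clusters avoid X`;
this file proves the two statements of that programme that need only Harris' inequality and the complement
involution:

* `Antithetic.harris_uniform`, `Antithetic.harris_uniform_centred`, `Antithetic.cross_le_same_abstract` — Harris–FKG
  for the counting weight on the Boolean lattice `Set ι` (Mathlib `fkg`), its centred form (`Σ a = Σ b = 0 ⇒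
  0 ≤ Σ a b` for increasing `a, b` of any sign), and the abstract `cross ≤ same` lemma (`Φ ≥ 0` increasing, `ψ₁ ≥ 0`
  increasing, `ψ₂` decreasing bounded, `Σ ψ₁ = Σ ψ₂` ⇒ `Σ Φ ψ₂ ≤ Σ Φ ψ₁`);
* `Antithetic.sum_red_eq_sum_blue` — `Σ_ω h(red ω) = Σ_ω h(blue ω)` (the complement involution);
* `Antithetic.antithetic_harris` — the sink-free case of (SC) in concordance form:
  `0 ≤ Σ_ω (F(red) − F(blue)) · (G(red) − G(blue))` for increasing `F, G` (MEMO-gen31 §1c, `R = ∅`);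
* `Antithetic.cross_le_same_harris` — the 'Harris part' of the coefficientwise BHK Theorem 1.1 (MEMO-gen31 §4b, the
  base case `X ∩ Y = ∅` of conjecture C11): for increasing `F, G ≥ 0` and decreasing `P, Q ≥ 0` (e.g. the indicators
  of `W ∈ 𝒰`, `W ∈ 𝒱`, `W ∌ X`, `W ∌ Y` as functions of the edge cluster),
  `Σ_ω F(red)P(red) · G(blue)Q(blue) ≤ Σ_ω F(red)G(red) · P(blue)Q(blue)`,
  i.e. `#{red ∈ 𝒰, red ∌ X, blue ∈ 𝒱, blue ∌ Y} ≤ #{red ∈ 𝒰∩𝒱, blue ∌ X ∪ Y}`.  The conjectured statement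
  inserts `red ∌ X∩Y` on the right (C11); with `X = Y` that is (SC).
[cite: VandenbergHaggstromKahn2005, Thm. 1.1 (pp. 3–5), Thm. 1.3 (p. 6), §1 p. 6 ("Harris' inequality")]
-/

noncomputable section

namespace Summit.CriticalPhenomena.PercolationContinuityZ3.Theorems

open Literature.Probability.Percolation
open scoped Classical

namespace Antithetic

section Lattice

variable {ι : Type*} [Fintype ι]

/-- **Harris–FKG for the counting weight** on the Boolean lattice `Set ι`: for nonnegative increasing `f, g`,
`(Σ f)(Σ g) ≤ |Set ι| · Σ f g`.  [cite: VandenbergHaggstromKahn2005, §1 p. 6 ("Harris' inequality"); Mathlib `fkg`] -/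
theorem harris_uniform {f g : Set ι → ℝ} (hf0 : ∀ a, 0 ≤ f a) (hg0 : ∀ a, 0 ≤ g a)
    (hf : Monotone f) (hg : Monotone g) :
    (∑ ω, f ω) * ∑ ω, g ω ≤ (Fintype.card (Set ι) : ℝ) * ∑ ω, f ω * g ω := by
  have h := fkg (μ := fun _ : Set ι => (1 : ℝ)) (f := f) (g := g) (fun _ => zero_le_one)
    (fun a => hf0 a) (fun a => hg0 a) hf hg (fun a b => by simp)
  simpa only [one_mul, Finset.sum_const, Finset.card_univ, nsmul_eq_mul, mul_one] using h

/-- Centred Harris for the counting weight: increasing `a, b` of any sign with `Σ a = 0`, `Σ b = 0` satisfy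
`0 ≤ Σ a b`. [folklore] -/
theorem harris_uniform_centred {a b : Set ι → ℝ} (ha : Monotone a) (hb : Monotone b)
    (ha0 : ∑ ω, a ω = 0) (hb0 : ∑ ω, b ω = 0) : 0 ≤ ∑ ω, a ω * b ω := by
  set ca := a ∅ with hca
  set cb := b ∅ with hcb
  have ha' : ∀ ω, 0 ≤ a ω - ca := fun ω => sub_nonneg.2 (ha (Set.empty_subset ω))
  have hb' : ∀ ω, 0 ≤ b ω - cb := fun ω => sub_nonneg.2 (hb (Set.empty_subset ω))
  have h := harris_uniform ha' hb' (fun x y hxy => sub_le_sub_right (ha hxy) _)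
    (fun x y hxy => sub_le_sub_right (hb hxy) _)
  set N : ℝ := (Fintype.card (Set ι) : ℝ) with hN
  have e1 : ∑ ω, (a ω - ca) = -(N * ca) := by
    rw [Finset.sum_sub_distrib, ha0, Finset.sum_const, Finset.card_univ, nsmul_eq_mul]; ring
  have e2 : ∑ ω, (b ω - cb) = -(N * cb) := by
    rw [Finset.sum_sub_distrib, hb0, Finset.sum_const, Finset.card_univ, nsmul_eq_mul]; ring
  have e3 : ∑ ω, (a ω - ca) * (b ω - cb) = ∑ ω, a ω * b ω + N * (ca * cb) := by
    have : ∀ ω, (a ω - ca) * (b ω - cb) = a ω * b ω - cb * a ω - ca * b ω + ca * cb :=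
      fun ω => by ring
    simp_rw [this]
    rw [Finset.sum_add_distrib, Finset.sum_sub_distrib, Finset.sum_sub_distrib, ← Finset.mul_sum,
      ← Finset.mul_sum, ha0, hb0, Finset.sum_const, Finset.card_univ, nsmul_eq_mul]
    ring
  rw [e1, e2, e3] at h
  have hNpos : (0 : ℝ) < N := by
    rw [hN]; exact_mod_cast Fintype.card_pos
  nlinarith

/-- **Abstract `cross ≤ same`**: for `Φ ≥ 0` increasing, `ψ₁ ≥ 0` increasing, `ψ₂` decreasing and bounded above,
with `Σ ψ₁ = Σ ψ₂`, one has `Σ Φ ψ₂ ≤ Σ Φ ψ₁` (two applications of Harris). [folklore] -/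
theorem cross_le_same_abstract {Φ ψ₁ ψ₂ : Set ι → ℝ} {M : ℝ} (hΦ0 : ∀ a, 0 ≤ Φ a) (hΦ : Monotone Φ)
    (hψ₁0 : ∀ a, 0 ≤ ψ₁ a) (hψ₁ : Monotone ψ₁) (hψ₂ : Antitone ψ₂) (hψ₂M : ∀ a, ψ₂ a ≤ M)
    (hsum : ∑ ω, ψ₁ ω = ∑ ω, ψ₂ ω) : ∑ ω, Φ ω * ψ₂ ω ≤ ∑ ω, Φ ω * ψ₁ ω := by
  set N : ℝ := (Fintype.card (Set ι) : ℝ) with hN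
  have hNpos : (0 : ℝ) < N := by
    rw [hN]; exact_mod_cast Fintype.card_pos
  -- Harris, both increasing
  have h1 : (∑ ω, Φ ω) * ∑ ω, ψ₁ ω ≤ N * ∑ ω, Φ ω * ψ₁ ω := harris_uniform hΦ0 hψ₁0 hΦ hψ₁
  -- Harris, increasing × (M − decreasing)
  have h2 := harris_uniform hΦ0 (g := fun ω => M - ψ₂ ω) (fun ω => sub_nonneg.2 (hψ₂M ω)) hΦ
    (fun x y hxy => sub_le_sub_left (hψ₂ hxy) M)
  have e1 : ∑ ω, (M - ψ₂ ω) = N * M - ∑ ω, ψ₂ ω := by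
    rw [Finset.sum_sub_distrib, Finset.sum_const, Finset.card_univ, nsmul_eq_mul]
  have e2 : ∑ ω, Φ ω * (M - ψ₂ ω) = M * ∑ ω, Φ ω - ∑ ω, Φ ω * ψ₂ ω := by
    have : ∀ ω, Φ ω * (M - ψ₂ ω) = M * Φ ω - Φ ω * ψ₂ ω := fun ω => by ring
    simp_rw [this]
    rw [Finset.sum_sub_distrib, ← Finset.mul_sum]
  rw [e1, e2] at h2
  -- combine: N Σ Φ ψ₂ ≤ (Σ Φ)(Σ ψ₂) = (Σ Φ)(Σ ψ₁) ≤ N Σ Φ ψ₁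
  have h3 : N * ∑ ω, Φ ω * ψ₂ ω ≤ (∑ ω, Φ ω) * ∑ ω, ψ₂ ω := by nlinarith
  rw [← hsum] at h3
  exact le_of_mul_le_mul_left (h3.trans h1) hNpos

end Lattice

section Clusters

variable {V : Type*} [Fintype V]

omit [Fintype V] in
/-- The red cluster `C_s(ω ∩ E)` is increasing in the configuration. [folklore] -/
theorem red_mono (E : Set (Sym2 V)) (s : V) :
    Monotone fun ω : Set (Sym2 V) => openEdgeCluster (ω ∩ E) s := fun _ _ h =>
  BHK2006.openEdgeCluster_mono (Set.inter_subset_inter_left E h) s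

omit [Fintype V] in
/-- The blue cluster `C_s(ωᶜ ∩ E)` is decreasing in the configuration. [folklore] -/
theorem blue_anti (E : Set (Sym2 V)) (s : V) :
    Antitone fun ω : Set (Sym2 V) => openEdgeCluster (ωᶜ ∩ E) s := fun _ _ h =>
  BHK2006.openEdgeCluster_mono (Set.inter_subset_inter_left E (Set.compl_subset_compl.2 h)) s

/-- **The complement involution**: summing a function of the blue cluster over all colourings equals summing the
same function of the red cluster (`ω ↦ ωᶜ` is a bijection of `Set (Sym2 V)`). [folklore] -/
theorem sum_red_eq_sum_blue (E : Set (Sym2 V)) (s : V) (h : Set (Sym2 V) → ℝ) :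
    ∑ ω : Set (Sym2 V), h (openEdgeCluster (ωᶜ ∩ E) s) =
      ∑ ω : Set (Sym2 V), h (openEdgeCluster (ω ∩ E) s) :=
  Fintype.sum_equiv (Function.Involutive.toPerm (compl : Set (Sym2 V) → Set (Sym2 V)) compl_involutive)
    (fun ω => h (openEdgeCluster (ωᶜ ∩ E) s)) (fun ω => h (openEdgeCluster (ω ∩ E) s)) (fun _ => rfl)

/-- **Antithetic Harris** (the sink-free case `X = ∅` of the antithetic BHK inequality, MEMO-gen31 §1c): for
increasing functions `F, G` of the cluster, the red and blue clusters of `s` are concordant on average,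
`0 ≤ Σ_ω (F(C_s(ω∩E)) − F(C_s(ωᶜ∩E))) · (G(C_s(ω∩E)) − G(C_s(ωᶜ∩E)))`;
equivalently `E[F(red)G(red)] ≥ E[F(red)G(blue)]` at `p = ½`.
[cite: VandenbergHaggstromKahn2005, §1 p. 6 ("Harris' inequality")] -/
theorem antithetic_harris (E : Set (Sym2 V)) (s : V) {F G : Set (Sym2 V) → ℝ} (hF : Monotone F)
    (hG : Monotone G) :
    0 ≤ ∑ ω : Set (Sym2 V), (F (openEdgeCluster (ω ∩ E) s) - F (openEdgeCluster (ωᶜ ∩ E) s)) *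
      (G (openEdgeCluster (ω ∩ E) s) - G (openEdgeCluster (ωᶜ ∩ E) s)) := by
  refine harris_uniform_centred ?_ ?_ ?_ ?_
  · exact fun x y hxy => sub_le_sub (hF (red_mono E s hxy)) (hF (blue_anti E s hxy))
  · exact fun x y hxy => sub_le_sub (hG (red_mono E s hxy)) (hG (blue_anti E s hxy))
  · rw [Finset.sum_sub_distrib, sum_red_eq_sum_blue E s F, sub_self]
  · rw [Finset.sum_sub_distrib, sum_red_eq_sum_blue E s G, sub_self]

/-- **`cross ≤ same`, Harris part of the coefficientwise BHK Theorem 1.1** (MEMO-gen31 §4b; base case `X ∩ Y = ∅`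
of conjecture C11): for increasing `F, G ≥ 0` and decreasing `P, Q ≥ 0` (functions of the edge cluster),
`Σ_ω F(red)P(red)·G(blue)Q(blue) ≤ Σ_ω F(red)G(red)·P(blue)Q(blue)`.
With indicator functions: `#{red ∈ 𝒰, red avoids X, blue ∈ 𝒱, blue avoids Y} ≤ #{red ∈ 𝒰 ∩ 𝒱, blue avoids X ∪ Y}`.
Proof: `Φ = F(red)Q(blue)` and `ψ₁ = G(red)P(blue)` are increasing, `ψ₂ = P(red)G(blue)` is decreasing,
`Σ ψ₁ = Σ ψ₂` by the complement involution; then `cross_le_same_abstract`.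
[cite: VandenbergHaggstromKahn2005, Thm. 1.1 (pp. 3–5)] -/
theorem cross_le_same_harris (E : Set (Sym2 V)) (s : V) {F G P Q : Set (Sym2 V) → ℝ}
    (hF0 : ∀ a, 0 ≤ F a) (hG0 : ∀ a, 0 ≤ G a) (hP0 : ∀ a, 0 ≤ P a) (hQ0 : ∀ a, 0 ≤ Q a)
    (hF : Monotone F) (hG : Monotone G) (hP : Antitone P) (hQ : Antitone Q) :
    ∑ ω : Set (Sym2 V), F (openEdgeCluster (ω ∩ E) s) * Q (openEdgeCluster (ωᶜ ∩ E) s) *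
        (P (openEdgeCluster (ω ∩ E) s) * G (openEdgeCluster (ωᶜ ∩ E) s)) ≤
      ∑ ω : Set (Sym2 V), F (openEdgeCluster (ω ∩ E) s) * Q (openEdgeCluster (ωᶜ ∩ E) s) *
        (G (openEdgeCluster (ω ∩ E) s) * P (openEdgeCluster (ωᶜ ∩ E) s)) := by
  -- bounds: `P ≤ P ∅` (decreasing), `G ≤ G univ` (increasing)
  have hPb : ∀ a, P a ≤ P ∅ := fun a => hP (Set.empty_subset a)
  have hGb : ∀ a, G a ≤ G Set.univ := fun a => hG (Set.subset_univ a)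
  refine cross_le_same_abstract (M := P ∅ * G Set.univ)
    (Φ := fun ω => F (openEdgeCluster (ω ∩ E) s) * Q (openEdgeCluster (ωᶜ ∩ E) s))
    (ψ₁ := fun ω => G (openEdgeCluster (ω ∩ E) s) * P (openEdgeCluster (ωᶜ ∩ E) s))
    (ψ₂ := fun ω => P (openEdgeCluster (ω ∩ E) s) * G (openEdgeCluster (ωᶜ ∩ E) s))
    ?_ ?_ ?_ ?_ ?_ ?_ ?_
  · exact fun a => mul_nonneg (hF0 _) (hQ0 _)
  · intro x y hxy
    exact mul_le_mul (hF (red_mono E s hxy)) (hQ (blue_anti E s hxy)) (hQ0 _) (hF0 _)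
  · exact fun a => mul_nonneg (hG0 _) (hP0 _)
  · intro x y hxy
    exact mul_le_mul (hG (red_mono E s hxy)) (hP (blue_anti E s hxy)) (hP0 _) (hG0 _)
  · intro x y hxy
    exact mul_le_mul (hP (red_mono E s hxy)) (hG (blue_anti E s hxy)) (hG0 _) (hP0 _)
  · intro a
    exact mul_le_mul (hPb _) (hGb _) (hG0 _) (hP0 _)
  · -- Σ_ω G(red)P(blue) = Σ_ω P(red)G(blue): the complement involution
    have h := Fintype.sum_equiv
      (Function.Involutive.toPerm (compl : Set (Sym2 V) → Set (Sym2 V)) compl_involutive)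
      (fun ω => G (openEdgeCluster (ω ∩ E) s) * P (openEdgeCluster (ωᶜ ∩ E) s))
      (fun ω => P (openEdgeCluster (ω ∩ E) s) * G (openEdgeCluster (ωᶜ ∩ E) s))
      (fun ω => by
        show G (openEdgeCluster (ω ∩ E) s) * P (openEdgeCluster (ωᶜ ∩ E) s) =
          P (openEdgeCluster (ωᶜ ∩ E) s) * G (openEdgeCluster (ωᶜᶜ ∩ E) s)
        rw [compl_compl, mul_comm])
    exact h

end Clusters

end Antithetic

end Summit.CriticalPhenomena.PercolationContinuityZ3.Theorems
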